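import Summits.CriticalPhenomena.PercolationContinuityZ3.Theorems.Transplant.FKConnectivityAllQPat3MinorDefs
import Summits.CriticalPhenomena.PercolationContinuityZ3.Theorems.Transplant.FKConnectivityAllQPat3TwoLevelFunctionals
import Summits.CriticalPhenomena.PercolationContinuityZ3.Theorems.Transplant.FKConnectivityAllQPat3GluingC
import HarnessLib

/-!
# Connectivity correlation inequalities for `φ_{w,q}`, every `q > 0` — gluing of two-level functionals on MINORS

Proof file (`--supports stmt-CriticalPhenomena-4575`), census lineage (gen 37) of LANE 2's FK sub-programme; builds on p205010
(kernel theorem, internal audit signed; external expert review pending).  No definitions, no named facts, no sorries.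

The `(E, C)`-versions ("contracted set riding along", fk-2's `FK.apExpC`) of census g36's gluing machinery for two-level members
(`…Pat3TwoLevelFunctionals.lean`): the fibre identity `FK.fib2C_sum`, the gluing decomposition `FK.mval2C_union_eq` of
`FK.mval2C` over a two-mark side (abstract in the class function, the join table and the level correction), the gluing step
`FK.mval2C_union_nonneg` (domination after symmetrisation, classes paired by `γ_A ↦ E_A ∖ γ_A`) and the step at the mark
`FK.mval2C_union_nonneg₂`.  The proofs are those of the `C = ∅` case with `γ ∪ C` in place of `γ` and `apExpC` in place of `apExp`
(set bookkeeping: census g36's `FK.union_union_distrib` / `FK.sdiff_union_union_distrib`).  Used by `…Pat3MinorInduction.lean`.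
[cite: Grimmett2006, §3.8 (pp. 61–62)] [cite: AyyerLinussonRavichandran2025, §7 (p. 22)]
-/

namespace Summit.CriticalPhenomena.PercolationContinuityZ3.Theorems

namespace FK

open SimpleGraph Literature.Probability.LatticeModels Literature.Probability.Percolation
open scoped Classical

variable {V : Type*}

section MinorGluing

/-- The inner sum over the three-mark side's minor is the evaluation of the fibre table of the two-level member. [folklore] -/
theorem fib2C_sum {join : Bool → Pat3 → Pat3} {corr : Bool → Pat3 → ℕ} (hcorr : ∀ a P, corr a P ≤ 1)
    (w' : ℕ → ℝ) (EB CB : Finset (Sym2 V)) (xB yB sB : V) (F : ℕ → Pat3 → Pat3 → ℤ) (a a' : Bool) :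
    ∑ γ ∈ EB.powerset,
      (w' (apExpC EB CB γ + (corr a (pat3 (γ ∪ CB) xB yB sB) + corr a' (pat3 (EB \ γ ∪ CB) xB yB sB))) *
          (F 0 (join a (pat3 (γ ∪ CB) xB yB sB)) (join a' (pat3 (EB \ γ ∪ CB) xB yB sB)) : ℝ) +
        w' (apExpC EB CB γ + (corr a (pat3 (γ ∪ CB) xB yB sB) + corr a' (pat3 (EB \ γ ∪ CB) xB yB sB)) + 1) *
          (F 1 (join a (pat3 (γ ∪ CB) xB yB sB)) (join a' (pat3 (EB \ γ ∪ CB) xB yB sB)) : ℝ)) =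
      lval4C w' EB CB xB yB sB (fib2 F join corr a a') := by
  unfold lval4C fib2
  refine Finset.sum_congr rfl fun γ _ => ?_
  set K := corr a (pat3 (γ ∪ CB) xB yB sB) + corr a' (pat3 (EB \ γ ∪ CB) xB yB sB) with hK
  have hK2 : K ≤ 2 := by
    have := hcorr a (pat3 (γ ∪ CB) xB yB sB)
    have := hcorr a' (pat3 (EB \ γ ∪ CB) xB yB sB)
    omega
  have hK4 : K ∈ Finset.range 4 := Finset.mem_range.2 (by omega)
  have hK4' : K + 1 ∈ Finset.range 4 := Finset.mem_range.2 (by omega)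
  simp only [Int.cast_add, Int.cast_ite, Int.cast_zero, mul_add, Finset.sum_add_distrib]
  congr 1
  · rw [Finset.sum_eq_single_of_mem K hK4]
    · simp
    · intro c _ hc
      simp [Ne.symm hc]
  · rw [Finset.sum_eq_single_of_mem (K + 1) hK4']
    · simp [add_assoc]
    · intro c _ hc
      simp [Ne.symm hc]

variable [Fintype V]

/-- **Gluing decomposition of `mval2C`** over a two-mark side: minor `(EA ∪ EB, CA ∪ CB)` with the pieces `(EA, CA)` (two-mark side,
classes `cls`) and `(EB, CB)` (three-mark side). [folklore] -/
theorem mval2C_union_eq {EA EB CA CB : Finset (Sym2 V)} (hd : Disjoint EA EB) {x y s xB yB sB : V}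
    (cls : Finset (Sym2 V) → Bool) (join : Bool → Pat3 → Pat3) (corr : Bool → Pat3 → ℕ)
    (hpat : ∀ γA ⊆ EA, ∀ γB ⊆ EB, pat3 (γA ∪ CA ∪ (γB ∪ CB)) x y s = join (cls γA) (pat3 (γB ∪ CB) xB yB sB))
    (hexp : ∀ γA ⊆ EA, ∀ γB ⊆ EB, apExpC (EA ∪ EB) (CA ∪ CB) (γA ∪ γB) + 2 * Fintype.card V =
      apExpC EA CA γA + apExpC EB CB γB +
        (corr (cls γA) (pat3 (γB ∪ CB) xB yB sB) + corr (cls (EA \ γA)) (pat3 (EB \ γB ∪ CB) xB yB sB)))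
    (hcorr : ∀ a P, corr a P ≤ 1) (w : ℕ → ℝ) (F : ℕ → Pat3 → Pat3 → ℤ) :
    mval2C (fun n => w (n + 2 * Fintype.card V)) (EA ∪ EB) (CA ∪ CB) x y s F =
      ∑ γA ∈ EA.powerset, lval4C (fun n => w (apExpC EA CA γA + n)) EB CB xB yB sB
        (fib2 F join corr (cls γA) (cls (EA \ γA))) := by
  unfold mval2C
  beta_reduce
  rw [sum_powerset_union_disj hd]
  refine Finset.sum_congr rfl fun γA hγA => ?_
  have hγA' := Finset.mem_powerset.1 hγA
  rw [← fib2C_sum hcorr]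
  refine Finset.sum_congr rfl fun γB hγB => ?_
  have hγB' := Finset.mem_powerset.1 hγB
  have e1 : apExpC (EA ∪ EB) (CA ∪ CB) (γA ∪ γB) + 2 * Fintype.card V =
      apExpC EA CA γA + (apExpC EB CB γB +
        (corr (cls γA) (pat3 (γB ∪ CB) xB yB sB) + corr (cls (EA \ γA)) (pat3 (EB \ γB ∪ CB) xB yB sB))) := by
    rw [hexp γA hγA' γB hγB', add_assoc]
  have e2 : apExpC (EA ∪ EB) (CA ∪ CB) (γA ∪ γB) + 1 + 2 * Fintype.card V =
      apExpC EA CA γA + (apExpC EB CB γB +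
        (corr (cls γA) (pat3 (γB ∪ CB) xB yB sB) + corr (cls (EA \ γA)) (pat3 (EB \ γB ∪ CB) xB yB sB)) + 1) := by
    have := hexp γA hγA' γB hγB'
    omega
  rw [Finset.union_union_union_comm, sdiff_union_union_distrib hd hγA' hγB', hpat γA hγA' γB hγB',
    hpat (EA \ γA) Finset.sdiff_subset (EB \ γB) Finset.sdiff_subset, e1, e2]

/-- **Gluing step for a two-level member on a minor** (two-mark side `(EA, CA)`, three-mark side `(EB, CB)`): domination of the
paired class fibres, after symmetrisation, by members valid on the three-mark side's minor transfers nonnegativity to the glued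
minor. [folklore] -/
theorem mval2C_union_nonneg {EA EB CA CB : Finset (Sym2 V)} (hd : Disjoint EA EB) {x y s xB yB sB : V}
    (cls : Finset (Sym2 V) → Bool) (join : Bool → Pat3 → Pat3) (corr : Bool → Pat3 → ℕ)
    (hpat : ∀ γA ⊆ EA, ∀ γB ⊆ EB, pat3 (γA ∪ CA ∪ (γB ∪ CB)) x y s = join (cls γA) (pat3 (γB ∪ CB) xB yB sB))
    (hexp : ∀ γA ⊆ EA, ∀ γB ⊆ EB, apExpC (EA ∪ EB) (CA ∪ CB) (γA ∪ γB) + 2 * Fintype.card V =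
      apExpC EA CA γA + apExpC EB CB γB +
        (corr (cls γA) (pat3 (γB ∪ CB) xB yB sB) + corr (cls (EA \ γA)) (pat3 (EB \ γB ∪ CB) xB yB sB)))
    (hcorr : ∀ a P, corr a P ≤ 1) (F : ℕ → Pat3 → Pat3 → ℤ) (G : Bool → Bool → ℕ → Pat3 → Pat3 → ℤ) (m k : Bool → Bool → ℕ)
    (hk : ∀ a a', k a a' + 1 < 4)
    (hdom : ∀ a a', ∀ c < 4, ∀ P Q,
      (m a a' : ℤ) * (shift2 (G a a') (k a a') c P Q + shift2 (G a a') (k a a') c Q P) ≤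
        2 * ((fib2 F join corr a a' c P Q + fib2 F join corr a' a c P Q) + (fib2 F join corr a a' c Q P + fib2 F join corr a' a c Q P)))
    (ihG : ∀ a a', ∀ w' : ℕ → ℝ, (∀ n, 0 ≤ w' n) → 0 ≤ mval2C w' EB CB xB yB sB (G a a'))
    (w : ℕ → ℝ) (hw : ∀ n, 0 ≤ w n) : 0 ≤ mval2C w (EA ∪ EB) (CA ∪ CB) x y s F := by
  set w₂ : ℕ → ℝ := fun n => w (n - 2 * Fintype.card V) with hw₂
  have hw₂' : ∀ n, 0 ≤ w₂ n := fun n => hw _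
  have hrew : mval2C w (EA ∪ EB) (CA ∪ CB) x y s F =
      mval2C (fun n => w₂ (n + 2 * Fintype.card V)) (EA ∪ EB) (CA ∪ CB) x y s F := by
    simp only [hw₂, Nat.add_sub_cancel]
  rw [hrew, mval2C_union_eq hd cls join corr hpat hexp hcorr w₂ F]
  set Φ : Finset (Sym2 V) → ℝ := fun γA =>
    lval4C (fun n => w₂ (apExpC EA CA γA + n)) EB CB xB yB sB (fib2 F join corr (cls γA) (cls (EA \ γA))) with hΦ
  have hpair : ∀ γA ∈ EA.powerset, 0 ≤ Φ γA + Φ (EA \ γA) := by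
    intro γA hγA
    have hγA' := Finset.mem_powerset.1 hγA
    simp only [hΦ]
    rw [Finset.sdiff_sdiff_eq_self hγA', apExpC_compl hγA', ← lval4C_add]
    have hwA : ∀ n, 0 ≤ w₂ (apExpC EA CA γA + n) := fun n => hw₂' _
    have h1 := lval4C_dom (E := EB) (C := CB) (x := xB) (y := yB) (s := sB) (w := fun n => w₂ (apExpC EA CA γA + n))
      (F := fun c P Q => fib2 F join corr (cls γA) (cls (EA \ γA)) c P Q + fib2 F join corr (cls (EA \ γA)) (cls γA) c P Q)
      (hk (cls γA) (cls (EA \ γA))) (hdom (cls γA) (cls (EA \ γA))) hwA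
    have h2 : 0 ≤ mval2C (fun n => w₂ (apExpC EA CA γA + (n + k (cls γA) (cls (EA \ γA))))) EB CB xB yB sB
        (G (cls γA) (cls (EA \ γA))) :=
      ihG _ _ _ fun n => hw₂' _
    have h3 : (0 : ℝ) ≤ (m (cls γA) (cls (EA \ γA)) : ℝ) := Nat.cast_nonneg _
    nlinarith
  have hsum : ∑ γA ∈ EA.powerset, Φ γA + ∑ γA ∈ EA.powerset, Φ (EA \ γA) =
      2 * ∑ γA ∈ EA.powerset, Φ γA := by
    rw [← sum_powerset_flip EA Φ]; ring
  have h2 : 0 ≤ ∑ γA ∈ EA.powerset, (Φ γA + Φ (EA \ γA)) := Finset.sum_nonneg hpair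
  rw [Finset.sum_add_distrib, hsum] at h2
  have : ∑ γA ∈ EA.powerset, Φ γA = ∑ γA ∈ EA.powerset,
      lval4C (fun n => w₂ (apExpC EA CA γA + n)) EB CB xB yB sB (fib2 F join corr (cls γA) (cls (EA \ γA))) := rfl
  rw [← this]
  linarith

/-- **Gluing step at the mark for a two-level member on a minor** (both sides two-mark): a termwise certificate after
symmetrising one side's bit pair gives nonnegativity on the glued minor. [folklore] -/
theorem mval2C_union_nonneg₂ {E₁ E₂ C₁ C₂ : Finset (Sym2 V)} (hd : Disjoint E₁ E₂) {x y s : V}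
    (c₁ c₂ : Finset (Sym2 V) → Bool)
    (hpat : ∀ γ₁ ⊆ E₁, ∀ γ₂ ⊆ E₂, pat3 (γ₁ ∪ C₁ ∪ (γ₂ ∪ C₂)) x y s = joinSerS (c₁ γ₁) (c₂ γ₂))
    (hexp : ∀ γ₁ ⊆ E₁, ∀ γ₂ ⊆ E₂,
      apExpC (E₁ ∪ E₂) (C₁ ∪ C₂) (γ₁ ∪ γ₂) + 2 * Fintype.card V = apExpC E₁ C₁ γ₁ + apExpC E₂ C₂ γ₂)
    (F : ℕ → Pat3 → Pat3 → ℤ)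
    (hcert : ∀ a a' b b' : Bool, ∀ c < 2, 0 ≤ F c (joinSerS a b) (joinSerS a' b') + F c (joinSerS a b') (joinSerS a' b))
    (w : ℕ → ℝ) (hw : ∀ n, 0 ≤ w n) : 0 ≤ mval2C w (E₁ ∪ E₂) (C₁ ∪ C₂) x y s F := by
  set w₂ : ℕ → ℝ := fun n => w (n - 2 * Fintype.card V) with hw₂
  have hw₂' : ∀ n, 0 ≤ w₂ n := fun n => hw _
  have hrew : mval2C w (E₁ ∪ E₂) (C₁ ∪ C₂) x y s F =
      mval2C (fun n => w₂ (n + 2 * Fintype.card V)) (E₁ ∪ E₂) (C₁ ∪ C₂) x y s F := by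
    simp only [hw₂, Nat.add_sub_cancel]
  rw [hrew]
  unfold mval2C
  beta_reduce
  rw [sum_powerset_union_disj hd]
  refine Finset.sum_nonneg fun γ₁ hγ₁ => ?_
  have hγ₁' := Finset.mem_powerset.1 hγ₁
  set Ψ : Finset (Sym2 V) → ℝ := fun γ₂ =>
    w₂ (apExpC (E₁ ∪ E₂) (C₁ ∪ C₂) (γ₁ ∪ γ₂) + 2 * Fintype.card V) *
        (F 0 (pat3 (γ₁ ∪ γ₂ ∪ (C₁ ∪ C₂)) x y s) (pat3 ((E₁ ∪ E₂) \ (γ₁ ∪ γ₂) ∪ (C₁ ∪ C₂)) x y s) : ℝ) +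
      w₂ (apExpC (E₁ ∪ E₂) (C₁ ∪ C₂) (γ₁ ∪ γ₂) + 1 + 2 * Fintype.card V) *
        (F 1 (pat3 (γ₁ ∪ γ₂ ∪ (C₁ ∪ C₂)) x y s) (pat3 ((E₁ ∪ E₂) \ (γ₁ ∪ γ₂) ∪ (C₁ ∪ C₂)) x y s) : ℝ) with hΨ
  have hpair : ∀ γ₂ ∈ E₂.powerset, 0 ≤ Ψ γ₂ + Ψ (E₂ \ γ₂) := by
    intro γ₂ hγ₂
    have hγ₂' := Finset.mem_powerset.1 hγ₂
    have e0 : apExpC (E₁ ∪ E₂) (C₁ ∪ C₂) (γ₁ ∪ γ₂) + 2 * Fintype.card V = apExpC E₁ C₁ γ₁ + apExpC E₂ C₂ γ₂ :=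
      hexp γ₁ hγ₁' γ₂ hγ₂'
    have e0' : apExpC (E₁ ∪ E₂) (C₁ ∪ C₂) (γ₁ ∪ (E₂ \ γ₂)) + 2 * Fintype.card V = apExpC E₁ C₁ γ₁ + apExpC E₂ C₂ γ₂ := by
      rw [hexp γ₁ hγ₁' (E₂ \ γ₂) Finset.sdiff_subset, apExpC_compl hγ₂']
    have e1 : apExpC (E₁ ∪ E₂) (C₁ ∪ C₂) (γ₁ ∪ γ₂) + 1 + 2 * Fintype.card V = apExpC E₁ C₁ γ₁ + apExpC E₂ C₂ γ₂ + 1 := by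
      omega
    have e1' : apExpC (E₁ ∪ E₂) (C₁ ∪ C₂) (γ₁ ∪ (E₂ \ γ₂)) + 1 + 2 * Fintype.card V =
        apExpC E₁ C₁ γ₁ + apExpC E₂ C₂ γ₂ + 1 := by omega
    simp only [hΨ]
    rw [sdiff_union_union_distrib hd hγ₁' hγ₂' C₁ C₂, sdiff_union_union_distrib hd hγ₁' Finset.sdiff_subset C₁ C₂,
      Finset.sdiff_sdiff_eq_self hγ₂', Finset.union_union_union_comm γ₁ γ₂ C₁ C₂, Finset.union_union_union_comm γ₁ (E₂ \ γ₂) C₁ C₂,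
      e0, e0', e1, e1',
      hpat γ₁ hγ₁' γ₂ hγ₂', hpat (E₁ \ γ₁) Finset.sdiff_subset (E₂ \ γ₂) Finset.sdiff_subset,
      hpat γ₁ hγ₁' (E₂ \ γ₂) Finset.sdiff_subset, hpat (E₁ \ γ₁) Finset.sdiff_subset γ₂ hγ₂']
    have c0 := hcert (c₁ γ₁) (c₁ (E₁ \ γ₁)) (c₂ γ₂) (c₂ (E₂ \ γ₂)) 0 (by norm_num)
    have c1 := hcert (c₁ γ₁) (c₁ (E₁ \ γ₁)) (c₂ γ₂) (c₂ (E₂ \ γ₂)) 1 (by norm_num)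
    have hw0 := hw₂' (apExpC E₁ C₁ γ₁ + apExpC E₂ C₂ γ₂)
    have hw1 := hw₂' (apExpC E₁ C₁ γ₁ + apExpC E₂ C₂ γ₂ + 1)
    have c0' : (0 : ℝ) ≤ (F 0 (joinSerS (c₁ γ₁) (c₂ γ₂)) (joinSerS (c₁ (E₁ \ γ₁)) (c₂ (E₂ \ γ₂))) : ℝ) +
        (F 0 (joinSerS (c₁ γ₁) (c₂ (E₂ \ γ₂))) (joinSerS (c₁ (E₁ \ γ₁)) (c₂ γ₂)) : ℝ) := by exact_mod_cast c0
    have c1' : (0 : ℝ) ≤ (F 1 (joinSerS (c₁ γ₁) (c₂ γ₂)) (joinSerS (c₁ (E₁ \ γ₁)) (c₂ (E₂ \ γ₂))) : ℝ) +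
        (F 1 (joinSerS (c₁ γ₁) (c₂ (E₂ \ γ₂))) (joinSerS (c₁ (E₁ \ γ₁)) (c₂ γ₂)) : ℝ) := by exact_mod_cast c1
    nlinarith
  have hsum : ∑ γ₂ ∈ E₂.powerset, Ψ γ₂ + ∑ γ₂ ∈ E₂.powerset, Ψ (E₂ \ γ₂) = 2 * ∑ γ₂ ∈ E₂.powerset, Ψ γ₂ := by
    rw [← sum_powerset_flip E₂ Ψ]; ring
  have h2 : 0 ≤ ∑ γ₂ ∈ E₂.powerset, (Ψ γ₂ + Ψ (E₂ \ γ₂)) := Finset.sum_nonneg hpair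
  rw [Finset.sum_add_distrib, hsum] at h2
  have : ∑ γ₂ ∈ E₂.powerset, Ψ γ₂ = ∑ γ₂ ∈ E₂.powerset,
      (w₂ (apExpC (E₁ ∪ E₂) (C₁ ∪ C₂) (γ₁ ∪ γ₂) + 2 * Fintype.card V) *
          (F 0 (pat3 (γ₁ ∪ γ₂ ∪ (C₁ ∪ C₂)) x y s) (pat3 ((E₁ ∪ E₂) \ (γ₁ ∪ γ₂) ∪ (C₁ ∪ C₂)) x y s) : ℝ) +
        w₂ (apExpC (E₁ ∪ E₂) (C₁ ∪ C₂) (γ₁ ∪ γ₂) + 1 + 2 * Fintype.card V) *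
          (F 1 (pat3 (γ₁ ∪ γ₂ ∪ (C₁ ∪ C₂)) x y s) (pat3 ((E₁ ∪ E₂) \ (γ₁ ∪ γ₂) ∪ (C₁ ∪ C₂)) x y s) : ℝ)) := rfl
  rw [← this]
  linarith

end MinorGluing

end FK

end Summit.CriticalPhenomena.PercolationContinuityZ3.Theorems
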